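import Mathlib
import HarnessLib

/-!
# A formally unramified, finite-type, radicial extension of height one is an isomorphism

Topic: `Literature/RingTheory/Etale`.  Let `S → R` be an injective ring map of commutative rings of prime
characteristic `p` such that

* `R` is of finite type and formally unramified over `S` (e.g. `R` étale over some `P` and `P → S → R`), and
* `R` is *radicial of height one* over `S`: `r ^ p` lies in the image of `S` for every `r : R`.

Then `S → R` is surjective (hence bijective).  This is the affine, height-one case of «an étale radicial
morphism is an open immersion» (EGA IV₄ 17.9.1; SGA 1 I 5.1); here it is proved from Mathlib's local structure
of unramified algebras with a unique prime above (A. Yang, `Mathlib.RingTheory.Unramified.LocalRing`):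
`R` is integral hence finite over `S`; above every prime `q` of `S` there is exactly one prime `Q` of `R`
(`r ∈ Q ⇒ r^p ∈ q R ⊆ Q'`); the residue extension `κ(Q)/κ(q)` is separable (unramified) and purely inseparable
(`x̄ ^ p ∈ κ(q)`), hence trivial (`Algebra.FormallyUnramified.range_eq_top_of_isPurelyInseparable`); so
`S_q → R_Q` is surjective, `S_r → R_r` is bijective for some `r ∉ q`
(`Localization.exists_awayMap_bijective_of_residueField_surjective`), and surjectivity is local
(`RingHom.surjective_ofLocalizationSpan`).

Main statements:
* `Literature.RingTheory.Etale.surjective_algebraMap_of_formallyUnramified_of_forall_pow_mem` — the criterion above;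
* `Literature.RingTheory.Etale.adjoin_range_frobenius_eq_top` — **surjectivity of the relative Frobenius**: a
  finite-type formally unramified algebra `R` over ANY commutative ring `P`, `char R = p`, is generated over `P` by
  its `p`-th powers, `P[R^p] = R` (SGA 5 XV §1 Prop. 2: for `R` étale over `P` the relative Frobenius
  `R ⊗_{P,Frob} P → R` is an isomorphism; here the surjectivity half, which needs neither flatness nor a base field).
For `R` étale over `κ[t₁, …, t_g]` with `κ` perfect this reads `R = R^p[t₁, …, t_g]`, the generation half of
«`(tᵢ)` is a `p`-basis of `R` over `R^p`».

References: A. Grothendieck, J. Dieudonné, EGA IV₄ (Publ. Math. IHÉS 32, 1967), Thm. 17.9.1, pp. 79–80 (held text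
`paper:url-27fa50b3a7fd`, p0078–p0080) [EGAIV4]; U. Görtz, T. Wedhorn, *Algebraic Geometry II*, Exercise 18.25 (relative
Frobenius: universal homeomorphism; `f` étale ⇔ `F_{X/S}` iso) [GortzWedhorn2023]; SGA 5 Exp. XV §1 Prop. 2.
Elementary given Mathlib; no named facts, no definitions.
-/

namespace Literature.RingTheory.Etale

universe u

open Function

section Radicial

variable {S R : Type*} [CommRing S] [CommRing R] [Algebra S R] {p : ℕ}

/-- In a radicial extension of height one (`r ^ p ∈ S` for all `r`, `p ≠ 0`), a prime of `R` is determined by the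
prime of `S` below it: two primes of `R` over the same prime of `S` are equal (a radicial morphism is injective on
spectra). [cite: EGAIV4, Thm. 17.9.1 (proof, p. 80: `f` radiciel)] -/
theorem eq_of_liesOver_of_forall_pow_mem (hp : p ≠ 0) (hrad : ∀ r : R, r ^ p ∈ (algebraMap S R).range)
    (q : Ideal S) (Q Q' : Ideal R) [Q.IsPrime] [Q'.IsPrime] [Q.LiesOver q] [Q'.LiesOver q] : Q = Q' := by
  suffices h : ∀ (Q Q' : Ideal R) [Q.IsPrime] [Q'.IsPrime] [Q.LiesOver q] [Q'.LiesOver q], Q ≤ Q' from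
    le_antisymm (h Q Q') (h Q' Q)
  intro Q Q' _ _ _ _ x hx
  obtain ⟨s, hs⟩ := hrad x
  have hxp : x ^ p ∈ Q := Q.pow_mem_of_mem hx p (Nat.pos_of_ne_zero hp)
  rw [← hs] at hxp
  have hsq : s ∈ q := by
    rw [Ideal.LiesOver.over (P := Q) (p := q)]
    exact hxp
  have hsQ' : algebraMap S R s ∈ Q' := by
    rw [Ideal.LiesOver.over (P := Q') (p := q)] at hsq
    exact hsq
  rw [hs] at hsQ'
  exact Ideal.IsPrime.mem_of_pow_mem ‹Q'.IsPrime› p hsQ'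

/-- A radicial extension of height one is integral (`r` is a root of `X ^ p - r ^ p`); with finite type this is the finiteness
step «f est un morphisme fini» of EGA IV 17.9.1. [cite: EGAIV4, Thm. 17.9.1 (proof, p. 79)] -/
theorem isIntegral_of_forall_pow_mem (hp : p ≠ 0) (hrad : ∀ r : R, r ^ p ∈ (algebraMap S R).range) :
    Algebra.IsIntegral S R := by
  refine ⟨fun r => IsIntegral.of_pow (Nat.pos_of_ne_zero hp) ?_⟩
  obtain ⟨s, hs⟩ := hrad r
  rw [← hs]
  exact isIntegral_algebraMap

/-- Above every prime of `S` there is exactly one prime of `R`, for `S → R` injective and radicial of height one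
(lying over for the integral extension, and injectivity on spectra). [cite: EGAIV4, Thm. 17.9.1 (proof, pp. 79–80)] -/
theorem exists_primesOver_eq_singleton_of_forall_pow_mem (hp : p ≠ 0)
    (hrad : ∀ r : R, r ^ p ∈ (algebraMap S R).range) [FaithfulSMul S R] (q : Ideal S) [q.IsPrime] :
    ∃ Q : Ideal R, Q.IsPrime ∧ Q.LiesOver q ∧ q.primesOver R = {Q} := by
  haveI := isIntegral_of_forall_pow_mem hp hrad
  obtain ⟨⟨Q, hQ, hQq⟩⟩ := Ideal.nonempty_primesOver (S := R) q
  refine ⟨Q, hQ, hQq, Set.eq_singleton_iff_unique_mem.mpr ⟨⟨hQ, hQq⟩, fun Q' hQ' => ?_⟩⟩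
  haveI := hQ'.1
  haveI := hQ'.2
  exact eq_of_liesOver_of_forall_pow_mem hp hrad q Q' Q

/-- **The residue field extension at the unique prime above is trivial.**  For `S → R` injective, radicial of
height one in characteristic `p`, and unramified at a prime `Q` of `R` above `q`, the map `κ(q) → κ(Q)` is
surjective: the extension is separable (unramified) and purely inseparable (`x̄ ^ p ∈ κ(q)`) — EGA's «`B/𝔪B` est à la fois
extension radicielle et extension finie séparable de `k` … donc isomorphe à `k`».
[cite: EGAIV4, Thm. 17.9.1 (proof, p. 80)] -/
theorem residueField_surjective_of_forall_pow_mem [Fact p.Prime] [CharP R p]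
    (hinj : Function.Injective (algebraMap S R)) (hrad : ∀ r : R, r ^ p ∈ (algebraMap S R).range)
    [Algebra.EssFiniteType S R] (q : Ideal S) (Q : Ideal R) [q.IsPrime] [Q.IsPrime] [Q.LiesOver q]
    [Algebra.IsUnramifiedAt S Q] [Algebra (Localization.AtPrime q) (Localization.AtPrime Q)]
    [Localization.AtPrime.IsLiesOverAlgebra q Q] :
    Function.Surjective (algebraMap q.ResidueField Q.ResidueField) := by
  have hp : p.Prime := Fact.out
  haveI : Module.Finite q.ResidueField Q.ResidueField := inferInstance
  haveI : Algebra.FiniteType q.ResidueField Q.ResidueField := Module.Finite.finiteType _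
  haveI : CharP S p := (algebraMap S R).charP hinj p
  -- characteristic of the residue field `κ(q)`
  haveI : CharP q.ResidueField p := by
    refine (CharP.charP_iff_prime_eq_zero hp).mpr ?_
    rw [← map_natCast (algebraMap S q.ResidueField) p, CharP.cast_eq_zero, map_zero]
  haveI : ExpChar q.ResidueField p := ExpChar.prime hp
  haveI : Algebra.FormallyUnramified q.ResidueField Q.ResidueField :=
    Algebra.FormallyUnramified.of_isSeparable _ _
  -- purely inseparable: `x̄ ^ p ∈ κ(q)`
  haveI : IsPurelyInseparable q.ResidueField Q.ResidueField := by
    rw [isPurelyInseparable_iff_pow_mem (F := q.ResidueField) p]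
    intro x
    refine ⟨1, ?_⟩
    rw [pow_one]
    obtain ⟨a, b, hb, rfl⟩ := IsFractionRing.div_surjective (A := R ⧸ Q) x
    obtain ⟨r, rfl⟩ := Ideal.Quotient.mk_surjective a
    obtain ⟨u, rfl⟩ := Ideal.Quotient.mk_surjective b
    obtain ⟨s, hs⟩ := hrad r
    obtain ⟨v, hv⟩ := hrad u
    have hr : algebraMap (R ⧸ Q) Q.ResidueField (Ideal.Quotient.mk Q r) ^ p =
        algebraMap q.ResidueField Q.ResidueField (algebraMap S q.ResidueField s) := by
      rw [Ideal.algebraMap_quotient_residueField_mk, ← map_pow, ← hs,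
        ← IsScalarTower.algebraMap_apply S q.ResidueField Q.ResidueField,
        IsScalarTower.algebraMap_apply S R Q.ResidueField]
    have hu : algebraMap (R ⧸ Q) Q.ResidueField (Ideal.Quotient.mk Q u) ^ p =
        algebraMap q.ResidueField Q.ResidueField (algebraMap S q.ResidueField v) := by
      rw [Ideal.algebraMap_quotient_residueField_mk, ← map_pow, ← hv,
        ← IsScalarTower.algebraMap_apply S q.ResidueField Q.ResidueField,
        IsScalarTower.algebraMap_apply S R Q.ResidueField]
    refine ⟨algebraMap S q.ResidueField s / algebraMap S q.ResidueField v, ?_⟩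
    rw [map_div₀, div_pow, hr, hu]
  exact RingHom.range_eq_top.mp
    (Algebra.FormallyUnramified.range_eq_top_of_isPurelyInseparable q.ResidueField Q.ResidueField)

/-- **A formally unramified, finite-type, radicial extension of height one is surjective.**  Let `S → R` be
injective with `R` of characteristic `p`, of finite type and formally unramified over `S`, and `r ^ p ∈ S` for all
`r : R`.  Then `S → R` is surjective.  (Affine height-one case of «étale + radicial ⇒ open immersion»,
EGA IV₄ 17.9.1 / SGA 1 I 5.1; proof through the unique prime above each prime, trivial residue extensions, and
A. Yang's `Localization.exists_awayMap_bijective_of_residueField_surjective`; flatness is not needed for this direction.)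
[cite: EGAIV4, Thm. 17.9.1 (c ⇒ a, pp. 79–80)] -/
theorem surjective_algebraMap_of_formallyUnramified_of_forall_pow_mem {S R : Type u} [CommRing S] [CommRing R]
    [Algebra S R] (p : ℕ) [Fact p.Prime] [CharP R p] [Algebra.FiniteType S R] [Algebra.FormallyUnramified S R]
    (hinj : Function.Injective (algebraMap S R)) (hrad : ∀ r : R, r ^ p ∈ (algebraMap S R).range) :
    Function.Surjective (algebraMap S R) := by
  classical
  have hp : p.Prime := Fact.out
  haveI : FaithfulSMul S R := (faithfulSMul_iff_algebraMap_injective S R).mpr hinj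
  haveI : Algebra.IsIntegral S R := isIntegral_of_forall_pow_mem hp.ne_zero hrad
  haveI : Module.Finite S R := Algebra.IsIntegral.finite
  -- for every maximal ideal `m` of `S`, an element `r ∉ m` with `S_r → R_r` bijective
  have key : ∀ m : Ideal S, m.IsMaximal → ∃ r ∉ m, Function.Bijective
      (Localization.awayMap (algebraMap S R) r) := by
    intro m hm
    obtain ⟨Q, hQ, hQm, hmQ⟩ := exists_primesOver_eq_singleton_of_forall_pow_mem hp.ne_zero hrad m
    letI := Localization.AtPrime.algebraOfLiesOver m Q
    haveI : Algebra.IsUnramifiedAt S Q := by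
      have : Algebra.FormallyUnramified R (Localization.AtPrime Q) :=
        Algebra.FormallyUnramified.of_isLocalization Q.primeCompl
      exact Algebra.FormallyUnramified.comp S R (Localization.AtPrime Q)
    obtain ⟨r, hr, h⟩ := Localization.exists_awayMap_bijective_of_residueField_surjective hmQ
      (residueField_surjective_of_forall_pow_mem hinj hrad m Q)
    exact ⟨r, hr, h r (dvd_refl r)⟩
  choose f hf hbij using key
  let s : Set S := {x | ∃ (m : Ideal S) (hm : m.IsMaximal), f m hm = x}
  have hs : Ideal.span s = ⊤ := by
    by_contra hne
    obtain ⟨m, hm, hle⟩ := Ideal.exists_le_maximal _ hne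
    exact hf m hm (hle (Ideal.subset_span ⟨m, hm, rfl⟩))
  refine RingHom.surjective_ofLocalizationSpan (algebraMap S R) s hs ?_
  rintro ⟨x, m, hm, rfl⟩
  exact (hbij m hm).2

end Radicial

section RelativeFrobenius

/-- **Surjectivity of the relative Frobenius of an unramified algebra.**  Let `R` be of finite type and formally
unramified (e.g. étale) over a commutative ring `P`, with `R` of prime characteristic `p`.  Then `R` is generated
as a `P`-algebra by its `p`-th powers: `P[R^p] = R`.  Equivalently, the relative Frobenius
`R ⊗_{P, Frob} P → R`, `r ⊗ a ↦ r^p a`, is surjective (SGA 5 XV §1 Prop. 2 (c) proves bijectivity for `R` étale).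
Proof: `surjective_algebraMap_of_formallyUnramified_of_forall_pow_mem` applied to the subalgebra `P[R^p] ⊆ R`, over
which `R` is still formally unramified and of finite type. [cite: GortzWedhorn2023, Exercise 18.25 (2)–(4)] -/
theorem adjoin_range_frobenius_eq_top {P R : Type u} [CommRing P] [CommRing R] [Algebra P R] (p : ℕ)
    [Fact p.Prime] [CharP R p] [Algebra.FiniteType P R] [Algebra.FormallyUnramified P R] :
    Algebra.adjoin P (Set.range (frobenius R p)) = ⊤ := by
  set A : Subalgebra P R := Algebra.adjoin P (Set.range (frobenius R p)) with hA
  haveI : Algebra.FiniteType (↥A) R := Algebra.FiniteType.of_restrictScalars_finiteType P A R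
  haveI : Algebra.FormallyUnramified (↥A) R := Algebra.FormallyUnramified.of_restrictScalars P A R
  have hsurj : Function.Surjective (algebraMap (↥A) R) :=
    surjective_algebraMap_of_formallyUnramified_of_forall_pow_mem p Subtype.val_injective fun r =>
      ⟨⟨frobenius R p r, Algebra.subset_adjoin ⟨r, rfl⟩⟩, rfl⟩
  rw [eq_top_iff]
  intro r _
  obtain ⟨a, rfl⟩ := hsurj r
  exact a.2

/-- Pointwise form of `adjoin_range_frobenius_eq_top`: every element of a finite-type formally unramified algebra
of characteristic `p` lies in the subalgebra generated by the `p`-th powers. [cite: GortzWedhorn2023, Exercise 18.25 (4)] -/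
theorem mem_adjoin_range_frobenius {P R : Type u} [CommRing P] [CommRing R] [Algebra P R] (p : ℕ)
    [Fact p.Prime] [CharP R p] [Algebra.FiniteType P R] [Algebra.FormallyUnramified P R] (r : R) :
    r ∈ Algebra.adjoin P (Set.range (frobenius R p)) := by
  rw [adjoin_range_frobenius_eq_top (P := P) p]
  exact Algebra.mem_top

end RelativeFrobenius

end Literature.RingTheory.Etale
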